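import Literature.NumberTheory.Sieve.HeathBrownCubicLemma81Inputs
import Literature.NumberTheory.Sieve.HeathBrownCubicLeadingB
import HarnessLib

/-!
# Heath-Brown's Lemma 8.1 from the Möbius sums `Σ(x; q)` (Lemma 3.8 reduced to two analytic inputs)

Assembly layer of the decomposition of **parity.S18**
(`Literature.NumberTheory.Sieve.setOf_prime_cube_add_two_mul_cube_infinite`) along D. R. Heath-Brown,
*Primes represented by `x³ + 2y³`*, Acta Math. 186 (2001), 1–84. `HeathBrownCubicSiegelWalfisz` reduced
the named fact **Lemma 3.8** (`HeathBrown2001_lemma_3_8`) to Lemmas 8.1 and 9.2 taken as hypotheses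
(`HeathBrown2001_lemma_3_8_of h81 h92`). This file PROVES Lemma 8.1 (p. 47) — the hypothesis `h81`
verbatim — from ONE analytic input, the evaluation of the Möbius sums on p. 51:

> "To handle the innermost sum we therefore investigate `Σ = ∑_{N(B) < x, (B, C) = 1} μ(B) log(x/N(B))/N(B)`,
> using the Dirichlet series `f(s) = ∑_{(B,C)=1} μ(B)N(B)^{−s} = ζ_K(s)⁻¹∏_{P ∣ C}(1 − N(P)^{−s})⁻¹`. The
> Perron formula shows that `Σ = (1/2πi)∫_{1−i∞}^{1+i∞} f(s+1)x^s s⁻² ds`. … Using the standard zero-free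
> region for `ζ_K(s)` we may therefore change the path of integration in the usual way to obtain
> `Σ = res{f(s+1)x^s s^{−2} : s = 0} + O(exp{−c√(log x)})` for a suitable constant `c`, whenever
> `N(C) ≤ x`. The residue is easily found to be `γ₀⁻¹N(C)/φ_K(C)`."

taken as the hypothesis `hMS` in the case `C = (q)` that the proof uses (`N(C) = q³`,
`φ_K(C) = φ_K(q)`): for `x ≥ 2`, `q ≥ 1`, `q³ ≤ x`,
`|∑_{N(A) < x, A + (q) = (1)} μ(A) log(x/N(A))/N(A) − q³/(γ₀φ_K(q))| ≤ C_M exp{−c_M√(log x)}`.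
(No zero-free region for `ζ_K` or Perron formula over `K` is in Mathlib; the tree's `ClassicalPsiData`
machinery of `Literature/NumberTheory/LFunctions` is the natural route to discharging `hMS`.)

Everything else is assembled from the tree exactly as printed (pp. 47–51):
(8.1) `cubeClassSum_eWeight_eq` (`HeathBrownCubicETermRearrangement`); the classes `J ∣ β, β ≡ α (mod q)`
evaluated by (8.5) — `abs_classSum_sub_main_le`, unifying `abs_sum_dvd_class_wDeriv_sub_le` (`n ≥ 1`,
`HeathBrownCubicETermClasses`) and `abs_sum_dvd_class_wDeriv_sub_le_zero` (`n = 0`,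
`HeathBrownCubicETermClassesZero`) as `≤ (8424c₃³/c₄ + 108)S₀²(ξ log X)^n` once `ξ log X ≥ 1` and
`S₀ ≤ 4c₃V^{1/3}`; "the error term clearly contributes `≪ S₀²M⁻¹(ξ log X)⁻¹L log L ≪ S₀³M⁻¹L⁻¹ ≪ S₀³M⁻¹exp{−c√(log L)}`
to (8.1)" (p. 50; `#{J : N(J) < L} ≤ A·L` by `exists_card_idealsLE_le_mul` of `HeathBrownCubicLeadingB`,
`S₀ ≥ L²`, and `(log L)L⁻¹ ≤ exp{−c√(log L)}` for large `X`); the main terms by (8.7) (`sum_moebius_main_eq`,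
`HeathBrownCubicETermMainTerm`), where "since `q ≤ L^{1/6}` we will have `N(IA) ≤ L^{1/2} ≤ L/N(IA)`"
makes `hMS` applicable at `x = L/N(I) ≥ L^{1/2}` (`moebiusSum_error_at_divisor`), and "using
multiplicativity, the main term is readily evaluated as `γ₀⁻¹N(q)/φ_K(q)` if `q` and `α` are coprime, and
zero otherwise" (`∑_{I ∣ (q), α ∈ I} μ(I) = ε(α, q)`, `sum_filter_mem_idealMoebius`,
`HeathBrownCubicIdealMoebius`), with error `≪ q⁻³#{I ∣ (q)}exp{−(c_M/2)√(log L)}`, `#{I ∣ (q)} ≤ A·q³`;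
finally "`𝓘 ≪ S₀³(ξ log X)^n`" by (8.4) (`abs_cubeIntegral_le`).

Results:

* **`HeathBrown2001_lemma_8_1_of_MS`** — `hMS →` (the `h81` of `HeathBrown2001_lemma_3_8_of`), with
  constants `C = A(max(C_M, 0) + 8424c₃³/c₄ + 108)`, `c = c_M/2`, `c' = 0`;
* **`HeathBrown2001_lemma_3_8_of_MS`** — `hMS → h92 → HeathBrown2001_lemma_3_8`: Lemma 3.8 now rests on
  exactly two analytic inputs, the Möbius sums over `K` (de la Vallée-Poussin saving) and Lemma 9.2
  (Mitsui's prime ideal theorem with Grössencharakteren, Siegel zeros), neither of which is in the tree.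

Parameters (`eventually_lemma81_params` of `HeathBrownCubicLemma81Inputs`, which also holds the small
inputs `abs_classSum_sub_main_le`, `moebiusSum_error_at_divisor`, `lemma81_decomp`): for `τ = (log log X)^{−ϖ}`, `ξ = τ⁵`, `L = X^{τ/2}` and large `X`,
`X ≥ 2`, `0 < τ ≤ 1/4`, `log L ≥ 2` (so `L ≥ 4`), `ξ log X ≥ 1`, `(log L)L⁻¹ ≤ exp{−c√(log L)}`.

## References

* D. R. Heath-Brown, *Primes represented by `x³ + 2y³`*, Acta Math. 186 (2001), 1–84: Lemma 8.1 (p. 47)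
  and its proof, §8 pp. 47–51. [cite: HeathBrownActa2001, Lemma 8.1]

## Mathlib / tree search

Mathlib: `Real.log_le_rpow_div`, `Real.add_one_le_exp`, `Real.exp_one_gt_d9`, `Filter.tendsto_atTop`,
`Ideal.finiteQuotientOfFreeOfNeBot`, `Nat.card_pos`. Tree: `HeathBrownCubicSiegelWalfisz`
(`HeathBrown2001_lemma_3_8_of`, `eventually_lemma38_params`, `eventually_mul_loglog_rpow_le`,
`side_pow_three_le_of_cubeCond`, `swMainTerm`, `eulerPhiK`, `coprimeInd`), `HeathBrownCubicETermRearrangement`,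
`HeathBrownCubicETermClasses(Zero)`, `HeathBrownCubicETermMainTerm`, `HeathBrownCubicIdealMoebius`,
`HeathBrownCubicCubeSums` (`volume_realCube`), `HeathBrownCubicWCalculus` (`wDeriv_nonneg`, `wDeriv_le`),
`HeathBrownCubicTypeIIWeightBounds` (`prod_mul_hbXi_mul_log`, `abs_idealMoebius_le`), `HeathBrownCubicLeadingB`
(`exists_card_idealsLE_le_mul`), `HeathBrownCubicTypeII` (`length_pos_of_coreAdmissible`,
`one_le_prod_of_coreAdmissible`, `hbL_pos`, `hbXi_pos`), `HeathBrownCubicSieveSetup` (`gamma₀_pos`).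
-/

noncomputable section

open Polynomial NumberField Finset MeasureTheory Filter Topology

namespace Literature.NumberTheory.Sieve.CubicSieve

open LFunctions.CubeRootTwoField CubicPrimes

/-! ### Lemma 8.1 from the Möbius sums -/

section Main

open scoped Classical in
/-- **Heath-Brown's Lemma 8.1 from the Möbius sums `Σ(x; q)`** (pp. 47–51). Lemma 8.1: "Let `𝒞 ⊆ ℝ³`
be as in Lemma 3.8. Define `N((x, y, z)) = x³ + 2y³ + 4z³ − 6xyz` and `𝓘 = ∫_𝒞 w'(N(𝐱)) dx dy dz`. Then
for any positive integer `q ≤ L^{1/6}` and any integer `α ∈ ℤ[2^{1/3}]` we have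
`∑_{β ≡ α (mod q), β̂ ∈ 𝒞} e_(β) = γ₀⁻¹M⁻¹(ξ log X)^{−n−1}𝓘ε(α, q)φ_K(q)⁻¹ + O(S₀³M⁻¹τ(q)^c exp{−c√(log L)})`."
Its proof rests on one analytic input, the evaluation of the Möbius sums (p. 51): "`Σ = ∑_{N(B) < x, (B, C) = 1} μ(B) log(x/N(B))/N(B)` …
Using the standard zero-free region for `ζ_K(s)` we may therefore change the path of integration in the
usual way to obtain `Σ = res{f(s+1)x^s s^{−2} : s = 0} + O(exp{−c√(log x)})` … whenever `N(C) ≤ x`. The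
residue is easily found to be `γ₀⁻¹N(C)/φ_K(C)`", which this theorem takes as the HYPOTHESIS `hMS`,
restricted to the case `C = (q)` (`N(C) = q³`, `φ_K(C) = φ_K(q)`) that the proof uses: for `x ≥ 2`, `q ≥ 1`,
`q³ ≤ x`, `|∑_{N(A) < x, A + (q) = (1)} μ(A) log(x/N(A))/N(A) − q³/(γ₀φ_K(q))| ≤ C_M exp{−c_M√(log x)}`.
Everything else is PROVED in the tree and assembled here exactly as printed: (8.1)
(`cubeClassSum_eWeight_eq`); for each `J` with `N(J) < L` the class `J ∣ β, β ≡ α (mod q)` evaluated by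
(8.5) with error `≪ S₀²(ξ log X)^n` (`abs_classSum_sub_main_le`, for `n ≥ 1` from (8.3), for `n = 0` from
the level-set geometry replacing Lemma 4.9), whose total over `N(J) < L` is
`≪ S₀²M⁻¹(ξ log X)⁻¹L log L ≪ S₀³M⁻¹L⁻¹ log L ≪ S₀³M⁻¹exp{−c√(log L)}` (p. 50, using `S₀ ≥ L²`); the
main terms rearranged by `I = (J, q)` ((8.7), `sum_moebius_main_eq`), "since `q ≤ L^{1/6}` we will have
`N(IA) ≤ L^{1/2} ≤ L/N(IA)`" so that `hMS` applies with `x = L/N(I) ≥ L^{1/2}`, and "using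
multiplicativity, the main term is `γ₀⁻¹N(q)/φ_K(q)` if `q` and `α` are coprime, and zero otherwise"
(`∑_{I ∣ (q), α ∈ I} μ(I) = ε(α, q)`, `sum_filter_mem_idealMoebius`), the error being
`≪ q⁻³#{I ∣ (q)}exp{−c√(log L^{1/2})}` with `#{I ∣ (q)} ≤ #{I : N(I) ≤ q³} ≪ q³`; finally
`𝓘 ≤ S₀³(ξ log X)^n` ((8.4)). The conclusion is the hypothesis `h81` of `HeathBrown2001_lemma_3_8_of`
verbatim (with `τ(q)^{c'}`, `c' = 0`). [cite: HeathBrownActa2001, Lemma 8.1] -/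
theorem HeathBrown2001_lemma_8_1_of_MS
    (hMS : ∃ C_M c_M : ℝ, 0 < c_M ∧ ∀ x : ℝ, 2 ≤ x → ∀ q : ℕ, 1 ≤ q → (q : ℝ) ^ 3 ≤ x →
      |∑ A ∈ (smallIdeals x).filter (fun A => A ⊔ Ideal.span {(q : 𝓞 K)} = ⊤),
          idealMoebius A * Real.log (x / Ideal.absNorm A) / Ideal.absNorm A -
        (q : ℝ) ^ 3 / (gamma₀ * eulerPhiK q)| ≤ C_M * Real.exp (-(c_M * Real.sqrt (Real.log x)))) :
    ∀ ϖ : ℝ, 0 < ϖ → ϖ < 1 / 5 → ∀ c₃ c₄ : ℝ, 0 < c₃ → 0 < c₄ →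
      ∃ C c c' X₀ : ℝ, 0 < c ∧ ∀ X : ℝ, X₀ ≤ X → ∀ (k : ℕ) (m : Fin k → ℕ),
        CoreAdmissible (hbTau ϖ X) m →
          ∀ q : ℕ, 1 ≤ q → (q : ℝ) ≤ hbL X (hbTau ϖ X) ^ (1 / 6 : ℝ) →
            ∀ (α : 𝓞 K) (V : ℝ) (a : ℝ × ℝ × ℝ) (S₀ : ℝ), 0 < V →
              hbL X (hbTau ϖ X) ^ 2 ≤ S₀ → CubeCond c₃ c₄ V a S₀ →
                |cubeClassSum (eWeight X (hbTau ϖ X) m) q α a S₀ -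
                    coprimeInd α q * swMainTerm X (hbTau ϖ X) m q a S₀| ≤
                  C * S₀ ^ 3 * (∏ i, (m i : ℝ))⁻¹ * ((Nat.divisors q).card : ℝ) ^ c' *
                    Real.exp (-(c * Real.sqrt (Real.log (hbL X (hbTau ϖ X))))) := by
  intro ϖ hϖ0 _hϖ5 c₃ c₄ hc₃ hc₄
  obtain ⟨C_M, c_M, hc_M, HMS⟩ := hMS
  obtain ⟨A, hA, hcardA⟩ := exists_card_idealsLE_le_mul
  obtain ⟨X₁, hX₁⟩ := Filter.eventually_atTop.mp (eventually_lemma81_params hϖ0 (half_pos hc_M))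
  set K₀ : ℝ := 8424 * (c₃ ^ 3 / c₄) + 108 with hK₀
  have hK₀0 : 0 ≤ K₀ := by positivity
  refine ⟨A * (max C_M 0 + K₀), c_M / 2, 0, X₁, half_pos hc_M, ?_⟩
  intro X hX k m hm q hq1 hq6 α V a S₀ hV hS₀ hcube
  obtain ⟨hX2, hτ0, hτ4, hℓ2, h𝔏1, hℓexp⟩ := hX₁ X hX
  clear hX₁
  -- notation and basic facts
  set τ := hbTau ϖ X with hτdef
  set L := hbL X τ with hLdef
  set ℓ := Real.log L with hℓdef
  set 𝔏 := hbXi τ * Real.log X with h𝔏def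
  set M := ∏ i, (m i : ℝ) with hMdef
  set 𝓘 := cubeIntegral X τ m a S₀ with h𝓘def
  set 𝔮 : Ideal (𝓞 K) := Ideal.span {(q : 𝓞 K)} with h𝔮def
  set c := c_M / 2 with hcdef
  have hX1 : 1 ≤ X := by linarith
  have hX0 : 0 < X := by linarith
  have hτ1 : τ ≤ 1 := by linarith
  have hk : 0 < k := length_pos_of_coreAdmissible hτ0 hm
  have hM1 : 1 ≤ M := one_le_prod_of_coreAdmissible hτ0 hτ1 hm
  have hM0 : 0 < M := by linarith
  have hLpos : 0 < L := hbL_pos hX0 τ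
  have hLexp : L = Real.exp ℓ := (Real.exp_log hLpos).symm
  have hL4 : 4 ≤ L := by
    rw [hLexp]; exact four_le_exp_two.trans (Real.exp_le_exp.mpr hℓ2)
  have hL1 : 1 ≤ L := by linarith
  have hS₀L : L ^ 2 ≤ S₀ := hS₀
  have hS₀pos : 0 < S₀ := lt_of_lt_of_le (by positivity) hS₀L
  have hq0 : 0 < q := hq1
  have hqR : (1 : ℝ) ≤ q := by exact_mod_cast hq1
  have h𝔮0 : 𝔮 ≠ ⊥ := by
    rw [h𝔮def, Ne, Ideal.span_singleton_eq_bot]; exact_mod_cast hq0.ne'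
  have hN𝔮 : (Ideal.absNorm 𝔮 : ℝ) = (q : ℝ) ^ 3 := by
    rw [h𝔮def, absNorm_span_natCast_K]; push_cast; ring
  -- `q³ ≤ L^{1/2}`, `q⁶ ≤ L`
  have hq3 : (q : ℝ) ^ 3 ≤ L ^ (1 / 2 : ℝ) := by
    calc (q : ℝ) ^ 3 ≤ (L ^ (1 / 6 : ℝ)) ^ 3 := pow_le_pow_left₀ (by positivity) hq6 3
      _ = L ^ (1 / 2 : ℝ) := by rw [← Real.rpow_natCast, ← Real.rpow_mul hLpos.le]; norm_num
  have hq6' : (q : ℝ) ^ 6 ≤ L := by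
    calc (q : ℝ) ^ 6 ≤ (L ^ (1 / 6 : ℝ)) ^ 6 := pow_le_pow_left₀ (by positivity) hq6 6
      _ = L := by rw [← Real.rpow_natCast, ← Real.rpow_mul hLpos.le]; norm_num
  have hLhalf : L ^ (1 / 2 : ℝ) * L ^ (1 / 2 : ℝ) = L := by
    rw [← Real.rpow_add hLpos]; norm_num
  have hLhalf1 : 1 ≤ L ^ (1 / 2 : ℝ) := Real.one_le_rpow hL1 (by norm_num)
  have hq3L : (q : ℝ) ^ 3 ≤ L := by
    calc (q : ℝ) ^ 3 ≤ L ^ (1 / 2 : ℝ) := hq3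
      _ = L ^ (1 / 2 : ℝ) * 1 := (mul_one _).symm
      _ ≤ L ^ (1 / 2 : ℝ) * L ^ (1 / 2 : ℝ) := mul_le_mul_of_nonneg_left hLhalf1 (by positivity)
      _ = L := hLhalf
  -- the cube: `S₀V^{-1/3} ≤ 4c₃`
  have hSV : S₀ * V ^ (-(1 / 3 : ℝ)) ≤ 4 * c₃ := side_mul_rpow_neg_le hc₃ hS₀pos hV hcube
  -- `P = M 𝔏^k`
  have hP : ∏ i, ((m i : ℝ) * hbXi τ * Real.log X) = M * 𝔏 ^ k := prod_mul_hbXi_mul_log m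
  have h𝔏pos : 0 < 𝔏 := lt_of_lt_of_le one_pos h𝔏1
  have hPpos : 0 < M * 𝔏 ^ k := by positivity
  -- Step 1: (8.1)
  set S : Ideal (𝓞 K) → ℝ := fun J =>
    ∑ v ∈ ((latticeCube a S₀).filter (fun v => (q : 𝓞 K) ∣ coordElt v - α)).filter
        (fun v => J ∣ Ideal.span {coordElt v}), wDeriv X τ m (Ideal.absNorm (Ideal.span {coordElt v}))
    with hSdef
  set w : Ideal (𝓞 K) → ℝ := fun J => idealMoebius J * Real.log (L / Ideal.absNorm J) with hwdef
  set mn : Ideal (𝓞 K) → ℝ := fun J =>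
    if α ∈ J ⊔ 𝔮 then ((Ideal.absNorm (J ⊓ 𝔮) : ℝ))⁻¹ * 𝓘 else 0 with hmndef
  set ind : Ideal (𝓞 K) → ℝ := fun J =>
    if α ∈ J ⊔ 𝔮 then ((Ideal.absNorm (J ⊓ 𝔮) : ℝ))⁻¹ else 0 with hinddef
  have h81 : cubeClassSum (eWeight X τ m) q α a S₀ = (M * 𝔏 ^ k)⁻¹ * ∑ J ∈ smallIdeals L, w J * S J := by
    rw [cubeClassSum_eWeight_eq hX0 m q α a S₀, hP]
  -- Step 2: the class estimate for each `J ≠ ⊥`, and the error sum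
  have hclassJ : ∀ J ∈ smallIdeals L, |w J * (S J - mn J)| ≤ ℓ * (K₀ * S₀ ^ 2 * 𝔏 ^ (k - 1)) := by
    intro J hJ
    by_cases hJ0 : J = ⊥
    · have : w J = 0 := by rw [hwdef]; simp only [hJ0, idealMoebius_bot, zero_mul]
      rw [this, zero_mul, abs_zero]; positivity
    · have hNJ : (Ideal.absNorm J : ℝ) < L := mem_smallIdeals_iff.mp hJ
      have hJq : (Ideal.absNorm J : ℝ) * (q : ℝ) ^ 3 ≤ S₀ := by
        calc (Ideal.absNorm J : ℝ) * (q : ℝ) ^ 3 ≤ L * L := by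
              refine mul_le_mul hNJ.le hq3L (by positivity) hLpos.le
          _ = L ^ 2 := (sq L).symm
          _ ≤ S₀ := hS₀L
      rw [abs_mul]
      exact mul_le_mul (abs_idealMoebius_mul_log_le hL1 hJ)
        (abs_classSum_sub_main_le hX1 hτ0.le h𝔏1 hk m hc₃ hc₄ hV hcube hSV hJ0 hq0 hJq α)
        (abs_nonneg _) (Real.log_nonneg hL1)
  have hcardS : ((smallIdeals L).card : ℝ) ≤ A * L := by
    have hfl : 1 ≤ ⌊L⌋₊ := Nat.le_floor (by exact_mod_cast hL1)
    calc ((smallIdeals L).card : ℝ) ≤ (idealsLE ⌊L⌋₊).card := by exact_mod_cast card_smallIdeals_le L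
      _ ≤ A * ⌊L⌋₊ := hcardA _ hfl
      _ ≤ A * L := mul_le_mul_of_nonneg_left (Nat.floor_le hLpos.le) hA.le
  have hE1 : |∑ J ∈ smallIdeals L, w J * (S J - mn J)| ≤ A * L * ℓ * (K₀ * S₀ ^ 2 * 𝔏 ^ (k - 1)) := by
    calc |∑ J ∈ smallIdeals L, w J * (S J - mn J)| ≤ ∑ J ∈ smallIdeals L, |w J * (S J - mn J)| :=
          Finset.abs_sum_le_sum_abs _ _
      _ ≤ ∑ _J ∈ smallIdeals L, ℓ * (K₀ * S₀ ^ 2 * 𝔏 ^ (k - 1)) := Finset.sum_le_sum hclassJ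
      _ = (smallIdeals L).card * (ℓ * (K₀ * S₀ ^ 2 * 𝔏 ^ (k - 1))) := by rw [Finset.sum_const, nsmul_eq_mul]
      _ ≤ A * L * (ℓ * (K₀ * S₀ ^ 2 * 𝔏 ^ (k - 1))) := by
          refine mul_le_mul_of_nonneg_right hcardS ?_
          have : 0 ≤ ℓ := by linarith
          positivity
      _ = A * L * ℓ * (K₀ * S₀ ^ 2 * 𝔏 ^ (k - 1)) := by ring
  -- Step 3: the main terms
  set D := (idealDivisors 𝔮).filter (fun I => α ∈ I) with hDdef
  set Sg : Ideal (𝓞 K) → ℝ := fun I =>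
    ∑ A' ∈ (smallIdeals (L / Ideal.absNorm I)).filter (fun A' => A' ⊔ 𝔮 = ⊤),
      idealMoebius A' * Real.log (L / Ideal.absNorm I / Ideal.absNorm A') / Ideal.absNorm A' with hSgdef
  have hmain : ∑ J ∈ smallIdeals L, w J * ind J = ((q : ℝ) ^ 3)⁻¹ * ∑ I ∈ D, idealMoebius I * Sg I :=
    sum_moebius_main_eq hq0 L α
  have hε : coprimeInd α q = ∑ I ∈ D, idealMoebius I := by
    rw [hDdef, sum_filter_mem_idealMoebius h𝔮0 α, coprimeInd_eq_ite_sup]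
  have hmn_ind : ∀ J, w J * mn J = 𝓘 * (w J * ind J) := by
    intro J; simp only [hmndef, hinddef]; split_ifs <;> ring
  -- the decomposition
  have hφ : (0 : ℝ) < eulerPhiK q := by exact_mod_cast eulerPhiK_pos hq0
  have hγ := gamma₀_pos
  set R : Ideal (𝓞 K) → ℝ := fun I => Sg I - (q : ℝ) ^ 3 / (gamma₀ * eulerPhiK q) with hRdef
  have hdecomp : cubeClassSum (eWeight X τ m) q α a S₀ - coprimeInd α q * swMainTerm X τ m q a S₀ =
      (M * 𝔏 ^ k)⁻¹ * ∑ J ∈ smallIdeals L, w J * (S J - mn J) +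
        (M * 𝔏 ^ k)⁻¹ * 𝓘 * ((q : ℝ) ^ 3)⁻¹ * ∑ I ∈ D, idealMoebius I * R I := by
    have hMT : swMainTerm X τ m q a S₀ = 𝓘 / (gamma₀ * eulerPhiK q * (M * 𝔏 ^ k)) := by
      show cubeIntegral X τ m a S₀ / (gamma₀ * (∏ i, (m i : ℝ)) * (eulerPhiK q : ℝ) * (hbXi τ * Real.log X) ^ k) = _
      ring
    rw [h81, hMT]
    exact lemma81_decomp (smallIdeals L) D w S mn ind (fun I => idealMoebius I) Sg hPpos.ne'
      (by positivity) (by positivity) hmn_ind hmain hε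
  -- Step 4: the Möbius sums at `x = L/N(I)`
  have hRI : ∀ I ∈ D, |idealMoebius I * R I| ≤ max C_M 0 * Real.exp (-(c * Real.sqrt ℓ)) := by
    intro I hI
    rw [hDdef, Finset.mem_filter, mem_idealDivisors_iff h𝔮0] at hI
    obtain ⟨hI𝔮, -⟩ := hI
    have hI0 : I ≠ ⊥ := by rintro rfl; exact h𝔮0 (zero_dvd_iff.mp hI𝔮)
    have hNIq : (Ideal.absNorm I : ℝ) ≤ (q : ℝ) ^ 3 := by
      rw [← hN𝔮]
      exact_mod_cast Nat.le_of_dvd (Nat.pos_of_ne_zero fun h => h𝔮0 (Ideal.absNorm_eq_zero_iff.mp h))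
        (Ideal.absNorm_dvd_absNorm_of_le (Ideal.le_of_dvd hI𝔮))
    have h := moebiusSum_error_at_divisor hc_M HMS hL4 hq1 hq6' hq3 hI0 hNIq
    calc |idealMoebius I * R I| = |idealMoebius I| * |R I| := abs_mul _ _
      _ ≤ 1 * (max C_M 0 * Real.exp (-(c * Real.sqrt ℓ))) :=
          mul_le_mul (abs_idealMoebius_le I) h (abs_nonneg _) zero_le_one
      _ = max C_M 0 * Real.exp (-(c * Real.sqrt ℓ)) := one_mul _
  have hcardD : (D.card : ℝ) ≤ A * (q : ℝ) ^ 3 := by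
    have h1 : D.card ≤ (idealsLE (Ideal.absNorm 𝔮)).card := by
      calc D.card ≤ (idealDivisors 𝔮).card := Finset.card_filter_le _ _
        _ ≤ (idealsLE (Ideal.absNorm 𝔮)).card := by
            unfold idealDivisors; exact Finset.card_filter_le _ _
    have h2 := hcardA (Ideal.absNorm 𝔮) (by
      exact Nat.pos_of_ne_zero fun h => h𝔮0 (Ideal.absNorm_eq_zero_iff.mp h))
    rw [hN𝔮] at h2
    exact le_trans (by exact_mod_cast h1) h2
  have hE2 : |∑ I ∈ D, idealMoebius I * R I| ≤ A * (q : ℝ) ^ 3 * (max C_M 0 * Real.exp (-(c * Real.sqrt ℓ))) := by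
    calc |∑ I ∈ D, idealMoebius I * R I| ≤ ∑ I ∈ D, |idealMoebius I * R I| := Finset.abs_sum_le_sum_abs _ _
      _ ≤ ∑ _I ∈ D, max C_M 0 * Real.exp (-(c * Real.sqrt ℓ)) := Finset.sum_le_sum hRI
      _ = D.card * (max C_M 0 * Real.exp (-(c * Real.sqrt ℓ))) := by rw [Finset.sum_const, nsmul_eq_mul]
      _ ≤ A * (q : ℝ) ^ 3 * (max C_M 0 * Real.exp (-(c * Real.sqrt ℓ))) :=
          mul_le_mul_of_nonneg_right hcardD (by positivity)
  -- Step 5: `|𝓘| ≤ S₀³𝔏^{k-1}`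
  have h𝓘 : |𝓘| ≤ S₀ ^ 3 * 𝔏 ^ (k - 1) := abs_cubeIntegral_le' hX1 hτ0.le hk m a hS₀pos.le
  -- Step 6: assemble
  have h𝔏k : 𝔏 ^ k = 𝔏 * 𝔏 ^ (k - 1) := by
    rw [← pow_succ', Nat.sub_add_cancel hk]
  have hterm1 : |(M * 𝔏 ^ k)⁻¹ * ∑ J ∈ smallIdeals L, w J * (S J - mn J)| ≤
      A * K₀ * S₀ ^ 3 * M⁻¹ * Real.exp (-(c * Real.sqrt ℓ)) := by
    have hx1 : 𝔏⁻¹ ≤ 1 := inv_le_one_of_one_le₀ h𝔏1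
    have hx2 : S₀ ^ 2 * L ≤ S₀ ^ 3 * L⁻¹ := by
      rw [le_mul_inv_iff₀ hLpos]
      calc S₀ ^ 2 * L * L = S₀ ^ 2 * L ^ 2 := by ring
        _ ≤ S₀ ^ 2 * S₀ := mul_le_mul_of_nonneg_left hS₀L (sq_nonneg _)
        _ = S₀ ^ 3 := by ring
    have hLinv : L⁻¹ = Real.exp (-ℓ) := by rw [hLexp, Real.exp_neg]
    rw [abs_mul, abs_of_pos (inv_pos.mpr hPpos)]
    calc (M * 𝔏 ^ k)⁻¹ * |∑ J ∈ smallIdeals L, w J * (S J - mn J)|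
        ≤ (M * 𝔏 ^ k)⁻¹ * (A * L * ℓ * (K₀ * S₀ ^ 2 * 𝔏 ^ (k - 1))) :=
          mul_le_mul_of_nonneg_left hE1 (inv_pos.mpr hPpos).le
      _ = (A * K₀ * M⁻¹ * ℓ) * (𝔏⁻¹ * (S₀ ^ 2 * L)) := by
          rw [h𝔏k]; field_simp
      _ ≤ (A * K₀ * M⁻¹ * ℓ) * (1 * (S₀ ^ 3 * L⁻¹)) :=
          mul_le_mul_of_nonneg_left (mul_le_mul hx1 hx2 (by positivity) zero_le_one) (by positivity)
      _ = A * K₀ * S₀ ^ 3 * M⁻¹ * (ℓ * Real.exp (-ℓ)) := by rw [← hLinv]; ring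
      _ ≤ A * K₀ * S₀ ^ 3 * M⁻¹ * Real.exp (-(c * Real.sqrt ℓ)) :=
          mul_le_mul_of_nonneg_left hℓexp (by positivity)
  have hterm2 : |(M * 𝔏 ^ k)⁻¹ * 𝓘 * ((q : ℝ) ^ 3)⁻¹ * ∑ I ∈ D, idealMoebius I * R I| ≤
      A * max C_M 0 * S₀ ^ 3 * M⁻¹ * Real.exp (-(c * Real.sqrt ℓ)) := by
    have hq30 : (0 : ℝ) < (q : ℝ) ^ 3 := by positivity
    rw [abs_mul, abs_mul, abs_mul, abs_of_pos (inv_pos.mpr hPpos), abs_of_pos (inv_pos.mpr hq30)]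
    calc (M * 𝔏 ^ k)⁻¹ * |𝓘| * ((q : ℝ) ^ 3)⁻¹ * |∑ I ∈ D, idealMoebius I * R I|
        ≤ (M * 𝔏 ^ k)⁻¹ * (S₀ ^ 3 * 𝔏 ^ (k - 1)) * ((q : ℝ) ^ 3)⁻¹ *
            (A * (q : ℝ) ^ 3 * (max C_M 0 * Real.exp (-(c * Real.sqrt ℓ)))) := by
          gcongr
      _ = A * max C_M 0 * S₀ ^ 3 * M⁻¹ * 𝔏⁻¹ * Real.exp (-(c * Real.sqrt ℓ)) := by
          rw [h𝔏k]; field_simp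
      _ ≤ A * max C_M 0 * S₀ ^ 3 * M⁻¹ * 1 * Real.exp (-(c * Real.sqrt ℓ)) := by
          gcongr; exact inv_le_one_of_one_le₀ h𝔏1
      _ = A * max C_M 0 * S₀ ^ 3 * M⁻¹ * Real.exp (-(c * Real.sqrt ℓ)) := by ring
  rw [hdecomp]
  calc |(M * 𝔏 ^ k)⁻¹ * ∑ J ∈ smallIdeals L, w J * (S J - mn J) +
        (M * 𝔏 ^ k)⁻¹ * 𝓘 * ((q : ℝ) ^ 3)⁻¹ * ∑ I ∈ D, idealMoebius I * R I|
      ≤ |(M * 𝔏 ^ k)⁻¹ * ∑ J ∈ smallIdeals L, w J * (S J - mn J)| +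
        |(M * 𝔏 ^ k)⁻¹ * 𝓘 * ((q : ℝ) ^ 3)⁻¹ * ∑ I ∈ D, idealMoebius I * R I| := abs_add_le _ _
    _ ≤ A * K₀ * S₀ ^ 3 * M⁻¹ * Real.exp (-(c * Real.sqrt ℓ)) +
        A * max C_M 0 * S₀ ^ 3 * M⁻¹ * Real.exp (-(c * Real.sqrt ℓ)) := add_le_add hterm1 hterm2
    _ = A * (max C_M 0 + K₀) * S₀ ^ 3 * M⁻¹ * ((Nat.divisors q).card : ℝ) ^ (0 : ℝ) *
        Real.exp (-(c * Real.sqrt ℓ)) := by rw [Real.rpow_zero]; ring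

/-- **Heath-Brown's Lemma 3.8 from the Möbius sums and Lemma 9.2**: with Lemma 8.1 now a theorem of the
tree up to the evaluation of `Σ(x; q)` (`HeathBrown2001_lemma_8_1_of_MS`), the glue
`HeathBrown2001_lemma_3_8_of` leaves exactly two analytic inputs — the Möbius sums over `K` with the
de la Vallée-Poussin saving (p. 51) and Lemma 9.2 (Mitsui's prime ideal theorem with Grössencharakteren,
§9). [cite: HeathBrownActa2001, Lemma 3.8] -/
theorem HeathBrown2001_lemma_3_8_of_MS
    (hMS : ∃ C_M c_M : ℝ, 0 < c_M ∧ ∀ x : ℝ, 2 ≤ x → ∀ q : ℕ, 1 ≤ q → (q : ℝ) ^ 3 ≤ x →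
      |∑ A ∈ (smallIdeals x).filter (fun A => A ⊔ Ideal.span {(q : 𝓞 K)} = ⊤),
          idealMoebius A * Real.log (x / Ideal.absNorm A) / Ideal.absNorm A -
        (q : ℝ) ^ 3 / (gamma₀ * eulerPhiK q)| ≤ C_M * Real.exp (-(c_M * Real.sqrt (Real.log x))))
    (h92 : ∀ ϖ : ℝ, 0 < ϖ → ϖ < 1 / 5 → ∀ A : ℕ, 0 < A → ∀ c₃ c₄ : ℝ, 0 < c₃ → 0 < c₄ →
      ∃ C c X₀ : ℝ, 0 < c ∧ ∀ X : ℝ, X₀ ≤ X → ∀ (k : ℕ) (m : Fin k → ℕ),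
        CoreAdmissible (hbTau ϖ X) m →
          ∀ q : ℕ, 1 ≤ q → (q : ℝ) ≤ Real.log (hbL X (hbTau ϖ X)) ^ A →
            ∀ α : 𝓞 K, IsCoprime α (q : 𝓞 K) →
              ∀ (V : ℝ) (a : ℝ × ℝ × ℝ) (S₀ : ℝ), 0 < V →
                hbL X (hbTau ϖ X) ^ 2 ≤ S₀ → CubeCond c₃ c₄ V a S₀ →
                  |cubeClassSum (dWeight X (hbTau ϖ X) m) q α a S₀ -
                      swMainTerm X (hbTau ϖ X) m q a S₀| ≤
                    C * V * Real.exp (-(c * Real.sqrt (Real.log (hbL X (hbTau ϖ X)))))) :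
    HeathBrown2001_lemma_3_8 :=
  HeathBrown2001_lemma_3_8_of (HeathBrown2001_lemma_8_1_of_MS hMS) h92

end Main

end Literature.NumberTheory.Sieve.CubicSieve

end
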